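import Summits.CriticalPhenomena.PercolationContinuityZ3.Theorems.PercNearOneGluingNoHeavyLowerTailCILCoreStep
import HarnessLib

/-!
# `NoHeavyLowerTail` (stmt-CriticalPhenomena-4575) — the CORE STEP without isolated or singleton residues

Prover `prim-gen-induct` (gen 6), `--supports stmt-CriticalPhenomena-4575`.  No definitions, no named facts, no sorries.

Refinement of `CoreStep.noHeavyLowerTail_of_coreStep` (`…CILCoreStep`): the core hypothesis may additionally assume that EVERY vertex
of the observer set `S` has at least two positive pairs (no isolated member, no pendant).  Ingredients:
* `CoreStep2.setCS_singleton_of_ih`: `CS_w({v}, c)` for a champion `c` of `w` and a non-relay vertex `v` with a positive pair, from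
  the induction hypothesis at smaller measure — the singleton branch of `setCS_of_step` made stand-alone (switch off all pairs at `v`,
  take a champion `c_F` of the result, `setCS_of_subgraph`, and shift the witness back to `c` by `glued_singleton`).
* `CoreStep2.step_dispatch2`: isolated members of `S` are removed one at a time (`PendantPeeling.setCS_events_of_isolated` with the
  weight function itself), by induction on `|S|`; a residual singleton is `setCS_singleton_of_ih`; then `CoreStep.step_dispatch`.
* `CoreStep2.noHeavyLowerTail_of_coreStep2`: **`NoHeavyLowerTail` follows from set-champion stability at observer sets `S` (light,
  `2 ≤ |S|`, champion not adjacent) in which every vertex has at least two positive pairs and whose positive pairs leave `S` towards at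
  least three distinct vertices** (given the induction hypothesis for all weight functions of smaller measure).
-/

noncomputable section

namespace Summit.CriticalPhenomena.PercolationContinuityZ3.Theorems

open MeasureTheory Set Literature.Probability.LatticeModels Literature.Probability.Percolation
open scoped Classical BigOperators

variable {n : ℕ}

namespace CoreStep2

open CutObserver

/-- **`CS_w({v}, c)` for a champion from the induction hypothesis.**  `v ∉ A` has a positive pair, `c ∈ A` is a champion of `w`, and
set-champion stability holds for champions of all weight functions of smaller measure at all nonempty observer sets disjoint from `A`.
(Switch off every pair at `v`; the champion `c_F` of the result satisfies `CS` at every `T ∋ v` there — induction hypothesis or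
lonely-cluster exchange —, hence `CS_w({v}, c_F)` by `setCS_of_subgraph`; the glued lightness at a singleton is the lightness, so the
championship of `c` shifts the witness.) -/
theorem setCS_singleton_of_ih (w : Sym2 (Fin n) → unitInterval) (A : Finset (Fin n)) (v c : Fin n) (j : ℕ)
    (hvA : v ∉ A) (hcA : c ∈ A) (hout : ∃ y : Fin n, y ≠ v ∧ w s(v, y) ≠ 0)
    (hchamp : ∀ a ∈ A,
      (prodBernoulli w).real {ω : BondConfig (Fin n) | (A.filter fun z => ω ∈ openConn a z).card ≤ j} ≤
        (prodBernoulli w).real {ω : BondConfig (Fin n) | (A.filter fun z => ω ∈ openConn c z).card ≤ j})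
    (ih : ∀ w' : Sym2 (Fin n) → unitInterval,
      (Fintype.card (Sym2 (Fin n)) + 1) * (Finset.univ.filter fun e => w' e ≠ 0).card +
          (Finset.univ.filter fun e => w' e ≠ 0 ∧ w' e ≠ 1).card <
        (Fintype.card (Sym2 (Fin n)) + 1) * (Finset.univ.filter fun e => w e ≠ 0).card +
          (Finset.univ.filter fun e => w e ≠ 0 ∧ w e ≠ 1).card →
      ∀ (T : Finset (Fin n)) (x : Fin n), Disjoint T A → T.Nonempty → x ∈ A →
      (∀ a ∈ A, (prodBernoulli w').real {ω : BondConfig (Fin n) | (A.filter fun z => ω ∈ openConn a z).card ≤ j} ≤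
        (prodBernoulli w').real {ω : BondConfig (Fin n) | (A.filter fun z => ω ∈ openConn x z).card ≤ j}) →
      (prodBernoulli w').real {ω : BondConfig (Fin n) | (∀ y ∈ T, ω ∉ openConn x y) ∧
          1 ≤ (A.filter fun z => ∃ y ∈ T, ω ∈ openConn y z).card ∧
          (A.filter fun z => ∃ y ∈ T, ω ∈ openConn y z).card ≤ j} ≤
        (prodBernoulli w').real {ω : BondConfig (Fin n) | (∀ y ∈ T, ω ∉ openConn x y) ∧
          (A.filter fun z => ω ∈ openConn x z).card ≤ j}) :
    (prodBernoulli w).real {ω : BondConfig (Fin n) | (∀ y ∈ ({v} : Finset (Fin n)), ω ∉ openConn c y) ∧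
        1 ≤ (A.filter fun z => ∃ y ∈ ({v} : Finset (Fin n)), ω ∈ openConn y z).card ∧
        (A.filter fun z => ∃ y ∈ ({v} : Finset (Fin n)), ω ∈ openConn y z).card ≤ j} ≤
      (prodBernoulli w).real {ω : BondConfig (Fin n) | (∀ y ∈ ({v} : Finset (Fin n)), ω ∉ openConn c y) ∧
        (A.filter fun z => ω ∈ openConn c z).card ≤ j} := by
  set S : Finset (Fin n) := {v} with hS
  have hSA : Disjoint S A := by rw [hS, Finset.disjoint_singleton_left]; exact hvA
  have hSne : S.Nonempty := by rw [hS]; exact Finset.singleton_nonempty v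
  obtain ⟨y₀, hy₀v, hwy₀⟩ := hout
  -- switch off every positive pair at `v`
  set F : Finset (Sym2 (Fin n)) := Finset.univ.filter fun e => w e ≠ 0 ∧ ∃ y, y ≠ v ∧ e = s(v, y) with hF
  have hFne : F.Nonempty := ⟨s(v, y₀), Finset.mem_filter.2 ⟨Finset.mem_univ _, hwy₀, y₀, hy₀v, rfl⟩⟩
  have hFmem : ∀ e ∈ F, w e ≠ 0 ∧ ∃ u ∈ S, ∃ y, y ≠ u ∧ e = s(u, y) := by
    intro e he
    obtain ⟨-, hwe, y, hy, rfl⟩ := Finset.mem_filter.1 he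
    exact ⟨hwe, v, by rw [hS]; exact Finset.mem_singleton_self v, y, hy, rfl⟩
  set wF : Sym2 (Fin n) → unitInterval := fun e => if e ∈ F then 0 else w e with hwF
  have hAne : A.Nonempty := ⟨c, hcA⟩
  obtain ⟨cF, hcFA, hcFmax⟩ := Finset.exists_max_image A
    (fun a => (prodBernoulli wF).real {ω : BondConfig (Fin n) | (A.filter fun z => ω ∈ openConn a z).card ≤ j}) hAne
  have hcFchamp : ∀ a ∈ A,
      (prodBernoulli wF).real {ω : BondConfig (Fin n) | (A.filter fun z => ω ∈ openConn a z).card ≤ j} ≤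
        (prodBernoulli wF).real {ω : BondConfig (Fin n) | (A.filter fun z => ω ∈ openConn cF z).card ≤ j} := hcFmax
  -- the measure of `wF` is smaller
  have hsub : (Finset.univ.filter fun e => wF e ≠ 0) ⊆ (Finset.univ.filter fun e => w e ≠ 0) \ F := by
    intro e he
    rw [Finset.mem_filter] at he
    rw [Finset.mem_sdiff, Finset.mem_filter]
    by_cases heF : e ∈ F
    · simp [hwF, heF] at he
    · simp only [hwF, heF, if_false] at he
      exact ⟨⟨Finset.mem_univ _, he.2⟩, heF⟩
  have hFsub : F ⊆ Finset.univ.filter fun e => w e ≠ 0 :=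
    fun e he => Finset.mem_filter.2 ⟨Finset.mem_univ _, (hFmem e he).1⟩
  have hcardF : (Fintype.card (Sym2 (Fin n)) + 1) * (Finset.univ.filter fun e => wF e ≠ 0).card +
        (Finset.univ.filter fun e => wF e ≠ 0 ∧ wF e ≠ 1).card <
      (Fintype.card (Sym2 (Fin n)) + 1) * (Finset.univ.filter fun e => w e ≠ 0).card +
        (Finset.univ.filter fun e => w e ≠ 0 ∧ w e ≠ 1).card := by
    have h1 := Finset.card_le_card hsub
    rw [Finset.card_sdiff_of_subset hFsub] at h1
    have h2 := Finset.card_pos.2 hFne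
    have hfsub : (Finset.univ.filter fun e => wF e ≠ 0 ∧ wF e ≠ 1) ⊆
        (Finset.univ.filter fun e => w e ≠ 0 ∧ w e ≠ 1) := by
      intro e he
      rw [Finset.mem_filter] at he ⊢
      by_cases heF : e ∈ F
      · simp [hwF, heF] at he
      · simp only [hwF, heF, if_false] at he
        exact ⟨Finset.mem_univ _, he.2⟩
    have h3 := Finset.card_le_card hfsub
    have h4 : (Finset.univ.filter fun e => w e ≠ 0 ∧ w e ≠ 1).card ≤ Fintype.card (Sym2 (Fin n)) :=
      Finset.card_le_univ _
    have h7 := Finset.card_le_card hFsub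
    have h6 : (Finset.univ.filter fun e => wF e ≠ 0).card + 1 ≤ (Finset.univ.filter fun e => w e ≠ 0).card := by
      omega
    have h5 := Nat.mul_le_mul_left (Fintype.card (Sym2 (Fin n)) + 1) h6
    rw [Nat.mul_add, Nat.mul_one] at h5
    generalize hP : (Fintype.card (Sym2 (Fin n)) + 1) * (Finset.univ.filter fun e => wF e ≠ 0).card = P at h5 ⊢
    generalize hQ : (Fintype.card (Sym2 (Fin n)) + 1) * (Finset.univ.filter fun e => w e ≠ 0).card = Q at h5 ⊢
    omega
  -- `CS_{wF}(T, cF)` for every `T ⊇ S` not containing `cF`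
  have hcFS : cF ∉ S := fun h => Finset.disjoint_left.1 hSA h hcFA
  have hFshape : ∀ e ∈ F, ∃ u ∈ S, ∃ y, y ≠ u ∧ e = s(u, y) := fun e he => (hFmem e he).2
  have hbase : ∀ T : Finset (Fin n), S ⊆ T → cF ∉ T →
      (prodBernoulli wF).real {ω : BondConfig (Fin n) |
          (∀ x ∈ T, ω ∉ openConn cF x) ∧ 1 ≤ (A.filter fun z => ∃ x ∈ T, ω ∈ openConn x z).card ∧
          (A.filter fun z => ∃ x ∈ T, ω ∈ openConn x z).card ≤ j} ≤
        (prodBernoulli wF).real {ω : BondConfig (Fin n) |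
          (∀ x ∈ T, ω ∉ openConn cF x) ∧ (A.filter fun z => ω ∈ openConn cF z).card ≤ j} := by
    intro T hST hcFT
    by_cases hTA : Disjoint T A
    · exact ih wF hcardF T cF hTA (hSne.mono hST) hcFA hcFchamp
    · rw [Finset.not_disjoint_iff] at hTA
      obtain ⟨a, haT, haA⟩ := hTA
      convert observerSet_le_of_lonelier wF A T a cF haT j (hcFchamp a haA) using 12
  have hCSF := setCS_of_subgraph A S cF j hcFS F hFshape w hbase S (Finset.Subset.refl _) hcFS
  -- shift the witness from `cF` to `c` (glued lightness at a singleton = lightness)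
  rw [bad_le_glued_iff_setCS w A S c j hcA]
  rw [bad_le_glued_iff_setCS w A S cF j hcFA] at hCSF
  refine hCSF.trans ?_
  rw [hS, glued_singleton, glued_singleton]
  exact hchamp cF hcFA

/-- **Dispatch with isolated members removed.**  In the setting of `setCS_of_step`'s hypothesis `hML` (one `(w, S, c)` with the induction
hypothesis `ih` for smaller measure): the step holds provided the CORE hypothesis `hcore` holds for every observer set `T` (with the same `w`,
`c`) in which every vertex has at least two positive pairs and whose positive pairs leave `T` towards at least three vertices.
(Isolated members are peeled by `PendantPeeling.setCS_events_of_isolated`, induction on `|S|`; a residual singleton is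
`setCS_singleton_of_ih`; the rest is `CoreStep.step_dispatch`.) -/
theorem step_dispatch2 (w : Sym2 (Fin n) → unitInterval) (A : Finset (Fin n)) (c : Fin n) (j : ℕ) (hcA : c ∈ A)
    (hchamp : ∀ a ∈ A,
      (prodBernoulli w).real {ω : BondConfig (Fin n) | (A.filter fun z => ω ∈ openConn a z).card ≤ j} ≤
        (prodBernoulli w).real {ω : BondConfig (Fin n) | (A.filter fun z => ω ∈ openConn c z).card ≤ j})
    (ih : ∀ w' : Sym2 (Fin n) → unitInterval,
      (Fintype.card (Sym2 (Fin n)) + 1) * (Finset.univ.filter fun e => w' e ≠ 0).card +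
          (Finset.univ.filter fun e => w' e ≠ 0 ∧ w' e ≠ 1).card <
        (Fintype.card (Sym2 (Fin n)) + 1) * (Finset.univ.filter fun e => w e ≠ 0).card +
          (Finset.univ.filter fun e => w e ≠ 0 ∧ w e ≠ 1).card →
      ∀ (T : Finset (Fin n)) (x : Fin n), Disjoint T A → T.Nonempty → x ∈ A →
      (∀ a ∈ A, (prodBernoulli w').real {ω : BondConfig (Fin n) | (A.filter fun z => ω ∈ openConn a z).card ≤ j} ≤
        (prodBernoulli w').real {ω : BondConfig (Fin n) | (A.filter fun z => ω ∈ openConn x z).card ≤ j}) →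
      (prodBernoulli w').real {ω : BondConfig (Fin n) | (∀ y ∈ T, ω ∉ openConn x y) ∧
          1 ≤ (A.filter fun z => ∃ y ∈ T, ω ∈ openConn y z).card ∧
          (A.filter fun z => ∃ y ∈ T, ω ∈ openConn y z).card ≤ j} ≤
        (prodBernoulli w').real {ω : BondConfig (Fin n) | (∀ y ∈ T, ω ∉ openConn x y) ∧
          (A.filter fun z => ω ∈ openConn x z).card ≤ j})
    (hcore : ∀ T : Finset (Fin n), Disjoint T A → 2 ≤ T.card →
      (∀ v ∈ T, (prodBernoulli w).real {ω : BondConfig (Fin n) | (A.filter fun z => ω ∈ openConn c z).card ≤ j} <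
        (prodBernoulli w).real {ω : BondConfig (Fin n) | (A.filter fun z => ω ∈ openConn v z).card ≤ j}) →
      (∃ v ∈ T, ∃ y, y ∉ T ∧ w s(v, y) ≠ 0) →
      (∀ v ∈ T, w s(c, v) = 0) →
      (∀ v ∈ T, ∃ u₁ u₂ : Fin n, u₁ ≠ v ∧ u₂ ≠ v ∧ u₁ ≠ u₂ ∧ w s(v, u₁) ≠ 0 ∧ w s(v, u₂) ≠ 0) →
      (∀ y z : Fin n, ∃ v ∈ T, ∃ u : Fin n, u ∉ T ∧ u ≠ y ∧ u ≠ z ∧ w s(v, u) ≠ 0) →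
      (prodBernoulli w).real {ω : BondConfig (Fin n) | (∀ y ∈ T, ω ∉ openConn c y) ∧
          1 ≤ (A.filter fun z => ∃ y ∈ T, ω ∈ openConn y z).card ∧
          (A.filter fun z => ∃ y ∈ T, ω ∈ openConn y z).card ≤ j} ≤
        (prodBernoulli w).real {ω : BondConfig (Fin n) | (∀ y ∈ T, ω ∉ openConn c y) ∧
          (A.filter fun z => ω ∈ openConn c z).card ≤ j}) :
    ∀ (m : ℕ) (S : Finset (Fin n)), S.card = m → Disjoint S A → 2 ≤ S.card →
      (∀ v ∈ S, (prodBernoulli w).real {ω : BondConfig (Fin n) | (A.filter fun z => ω ∈ openConn c z).card ≤ j} <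
        (prodBernoulli w).real {ω : BondConfig (Fin n) | (A.filter fun z => ω ∈ openConn v z).card ≤ j}) →
      (∃ v ∈ S, ∃ y, y ∉ S ∧ w s(v, y) ≠ 0) →
      (∀ v ∈ S, w s(c, v) = 0) →
      (prodBernoulli w).real {ω : BondConfig (Fin n) | (∀ y ∈ S, ω ∉ openConn c y) ∧
          1 ≤ (A.filter fun z => ∃ y ∈ S, ω ∈ openConn y z).card ∧
          (A.filter fun z => ∃ y ∈ S, ω ∈ openConn y z).card ≤ j} ≤
        (prodBernoulli w).real {ω : BondConfig (Fin n) | (∀ y ∈ S, ω ∉ openConn c y) ∧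
          (A.filter fun z => ω ∈ openConn c z).card ≤ j} := by
  intro m
  induction m using Nat.strong_induction_on with
  | _ m ihm =>
    intro S hSm hSA hS2 hlight hout hna
    have hcS : c ∉ S := fun h => Finset.disjoint_left.1 hSA h hcA
    by_cases hiso : ∃ v ∈ S, ∀ u : Fin n, u ≠ v → w s(v, u) = 0
    · -- peel an isolated member
      obtain ⟨v, hvS, hv⟩ := hiso
      have hcv : c ≠ v := fun h => hcS (h ▸ hvS)
      obtain ⟨hL, hR⟩ := PendantPeeling.setCS_events_of_isolated w A S v c j hSA hvS hcv hv
      rw [hL, hR]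
      set S' := S.erase v with hS'
      obtain ⟨v₀, hv₀S, y₀, hy₀S, hwy₀⟩ := hout
      have hv₀v : v₀ ≠ v := by
        rintro rfl
        have hyv : y₀ ≠ v₀ := fun h => hy₀S (h ▸ hv₀S)
        exact hwy₀ (hv y₀ hyv)
      have hv₀S' : v₀ ∈ S' := Finset.mem_erase.2 ⟨hv₀v, hv₀S⟩
      have hS'A : Disjoint S' A := Finset.disjoint_of_subset_left (Finset.erase_subset _ _) hSA
      have hcardS' : S'.card + 1 = S.card := by rw [hS']; exact Finset.card_erase_add_one hvS
      by_cases h2 : 2 ≤ S'.card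
      · exact ihm S'.card (by omega) S' rfl hS'A h2 (fun u hu => hlight u (Finset.mem_of_mem_erase hu))
          ⟨v₀, hv₀S', y₀, fun h => hy₀S (Finset.mem_of_mem_erase h), hwy₀⟩ (fun u hu => hna u (Finset.mem_of_mem_erase hu))
      · -- `S' = {v₀}`
        have hS'1 : S' = {v₀} := by
          have hc1 : S'.card = 1 := by
            have := Finset.card_pos.2 ⟨v₀, hv₀S'⟩; omega
          obtain ⟨x, hx⟩ := Finset.card_eq_one.1 hc1
          rw [hx] at hv₀S'; rw [Finset.mem_singleton.1 hv₀S']; exact hx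
        rw [hS'1]
        have hv₀A : v₀ ∉ A := Finset.disjoint_left.1 hSA hv₀S
        have hy₀v₀ : y₀ ≠ v₀ := fun h => hy₀S (h ▸ hv₀S)
        exact setCS_singleton_of_ih w A v₀ c j hv₀A hcA ⟨y₀, hy₀v₀, hwy₀⟩ hchamp ih
    · -- no isolated member: the core dispatch
      push Not at hiso
      refine CoreStep.step_dispatch w A S c j hSA hS2 hcA hchamp hout hna ih ?_
      intro hnp h3
      refine hcore S hSA hS2 hlight hout hna ?_ h3
      intro v hv
      obtain ⟨u₁, hu₁v, hwu₁⟩ := hiso v hv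
      obtain ⟨u₂, hu₂v, hu₂u₁, hwu₂⟩ := hnp v hv u₁ hu₁v hwu₁
      exact ⟨u₁, u₂, hu₁v, hu₂v, hu₂u₁.symm, hwu₁, hwu₂⟩

/-- **The crux from the CORE STEP, isolated members and pendants excluded.**  `NoHeavyLowerTail` follows from set-champion
stability at observer sets in which EVERY vertex has at least two positive pairs and whose positive pairs leave the set towards at
least three distinct vertices (light set, `2 ≤ |S|`, non-adjacent champion, induction hypothesis for all weight functions of smaller
measure available). -/
theorem noHeavyLowerTail_of_coreStep2
    (hcore : ∀ (n : ℕ) (w : Sym2 (Fin n) → unitInterval) (A S : Finset (Fin n)) (c : Fin n) (j : ℕ),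
      Disjoint S A → 2 ≤ S.card → c ∈ A →
      (∀ a ∈ A, (prodBernoulli w).real {ω : BondConfig (Fin n) | (A.filter fun z => ω ∈ openConn a z).card ≤ j} ≤
        (prodBernoulli w).real {ω : BondConfig (Fin n) | (A.filter fun z => ω ∈ openConn c z).card ≤ j}) →
      (∀ v ∈ S, (prodBernoulli w).real {ω : BondConfig (Fin n) | (A.filter fun z => ω ∈ openConn c z).card ≤ j} <
        (prodBernoulli w).real {ω : BondConfig (Fin n) | (A.filter fun z => ω ∈ openConn v z).card ≤ j}) →
      (∃ v ∈ S, ∃ y, y ∉ S ∧ w s(v, y) ≠ 0) →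
      (∀ v ∈ S, w s(c, v) = 0) →
      (∀ v ∈ S, ∃ u₁ u₂ : Fin n, u₁ ≠ v ∧ u₂ ≠ v ∧ u₁ ≠ u₂ ∧ w s(v, u₁) ≠ 0 ∧ w s(v, u₂) ≠ 0) →
      (∀ y z : Fin n, ∃ v ∈ S, ∃ u : Fin n, u ∉ S ∧ u ≠ y ∧ u ≠ z ∧ w s(v, u) ≠ 0) →
      (∀ w' : Sym2 (Fin n) → unitInterval,
        (Fintype.card (Sym2 (Fin n)) + 1) * (Finset.univ.filter fun e => w' e ≠ 0).card +
            (Finset.univ.filter fun e => w' e ≠ 0 ∧ w' e ≠ 1).card <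
          (Fintype.card (Sym2 (Fin n)) + 1) * (Finset.univ.filter fun e => w e ≠ 0).card +
            (Finset.univ.filter fun e => w e ≠ 0 ∧ w e ≠ 1).card →
        ∀ (T : Finset (Fin n)) (x : Fin n), Disjoint T A → T.Nonempty → x ∈ A →
        (∀ a ∈ A, (prodBernoulli w').real {ω : BondConfig (Fin n) | (A.filter fun z => ω ∈ openConn a z).card ≤ j} ≤
          (prodBernoulli w').real {ω : BondConfig (Fin n) | (A.filter fun z => ω ∈ openConn x z).card ≤ j}) →
        (prodBernoulli w').real {ω : BondConfig (Fin n) | (∀ y ∈ T, ω ∉ openConn x y) ∧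
            1 ≤ (A.filter fun z => ∃ y ∈ T, ω ∈ openConn y z).card ∧
            (A.filter fun z => ∃ y ∈ T, ω ∈ openConn y z).card ≤ j} ≤
          (prodBernoulli w').real {ω : BondConfig (Fin n) | (∀ y ∈ T, ω ∉ openConn x y) ∧
            (A.filter fun z => ω ∈ openConn x z).card ≤ j}) →
      (prodBernoulli w).real {ω : BondConfig (Fin n) | (∀ y ∈ S, ω ∉ openConn c y) ∧
          1 ≤ (A.filter fun z => ∃ y ∈ S, ω ∈ openConn y z).card ∧
          (A.filter fun z => ∃ y ∈ S, ω ∈ openConn y z).card ≤ j} ≤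
        (prodBernoulli w).real {ω : BondConfig (Fin n) | (∀ y ∈ S, ω ∉ openConn c y) ∧
          (A.filter fun z => ω ∈ openConn c z).card ≤ j}) :
    Summit.CriticalPhenomena.PercolationContinuityZ3.Theses.PercNearOneGluing.NoHeavyLowerTail :=
  noHeavyLowerTail_of_step fun n w A S c j hSA hS2 hcA hchamp hlight hout hna ih =>
    step_dispatch2 w A c j hcA hchamp ih
      (fun T hTA hT2 hTlight hTout hTna hdeg h3 => hcore n w A T c j hTA hT2 hcA hchamp hTlight hTout hTna hdeg h3 ih)
      S.card S rfl hSA hS2 hlight hout hna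

end CoreStep2

end Summit.CriticalPhenomena.PercolationContinuityZ3.Theorems
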